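import Literature.NumberTheory.GaloisCohomology.TateEulerCharacteristicLayerOfOpenNormal
import Literature.NumberTheory.GaloisCohomology.TateEulerCharacteristicPrimeToPBaseInputs
import Literature.NumberTheory.GaloisRepresentations.ContinuousCohomologyTwistEulerCharacteristicPsi
import Literature.NumberTheory.GaloisRepresentations.ContinuousCohomologyZeroIsoNaturality
import Literature.NumberTheory.GaloisRepresentations.RestrictedRamificationBaseFieldComplexPlaces
import Literature.NumberTheory.GaloisRepresentations.SUnitsCoinducedKummerLayer
import Literature.NumberTheory.GaloisRepresentations.SUnitsRestrictedCohomologyDegreeOneFinite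
import HarnessLib

/-!
# Tate's global Euler characteristic at a totally complex field: the prime-to-`p` base case `hbase`
# from the Kummer class identity for `E_S[p]` at a Galois layer (the ADAPTER of lane «TATE-EPC-TC»)

Topic `NumberTheory/GaloisCohomology`; namespace `Literature.NumberTheory.GaloisCohomology`.  Theorems
only; no definition, no named fact, no `sorry`, no instance, no notation.

`K` totally complex, `S ⊇ S_p` finite, `G_S = G_{K,S}`, `ρ₀ ≅ μ_p` (`MuCarrier K p`), `W` open normal in
`G_S` fixing `μ_p`, `U ⊇ W` with `p ∤ [U : W]`, `σ` a representation of `G_S ⧸ W` on a finite `M` with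
`pM = 0`.  The hypothesis `hbase` of
`TateGlobalEulerCharacteristicTCOfBase.tateGlobalEulerPoincareCharacteristic_of_isTotallyComplex_of_base`
asks for `v_p #H⁰(U, M) − v_p #H¹(U, M) + v_p #H²(U, M) + [G_S : U] · r₂(K) · v_p #M = 0`.  The lane's
Kummer computation (brick B8-arith, `TateEulerCharacteristicKummerClasses.additive_coindOpen_mu_euler_of_brauerClass`)
delivers, for the coefficient module `μ := E_S[p]` (the `p`-torsion of `Layers.resRep K S H`, the
`N_S`-invariant `S`-units restricted to `U = galoisGroupAbove S H`) and the open normal subgroup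
`layerSubgroup S hHo E hF hS` of `↥U` cut out by a finite Galois LAYER `E` of `K_S`, the equivariant
identity `ψ((Maps(Δ, μ))^U) + ψ(𝓗²(μ)) + r₂(K̄^H) • ψ(𝔽_p[Δ]) = ψ(𝓗¹(μ))` for every additive invariant `ψ`
— a different currency (another group type, another open subgroup, another model of `μ_p`, another
exponent, degree `0` as invariants).  This file is the ADAPTER between the two:

* **`euler_restrict_of_layerIdentity`**: for `W ≤ U ≤ G_S` as above, IF that identity is available for
  every open `H ≤ Γ_K` containing `N_S` with `galoisGroupAbove S H = U` and every finite Galois layer `E`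
  of `K_S` above `K̄^H` with `layerSubgroup S hHo E hF hS = W ∩ U` (hypothesis `hId` — quantified over all
  such `(H, E)`, so that no identification of types is ever needed; it is the conclusion of
  `additive_coindOpen_mu_euler_of_brauerClass` token for token), THEN the `hbase` line holds for `U`
  with exponent `[G_S : U] · r₂(K)`.  Proof: `H := π⁻¹ U` (`galoisGroupAbove_comap_toUnramifiedQuot`),
  the layer of `exists_galLayer_layerSubgroup_eq`, the degree-`0` rewrite
  `additive_coindOpenInvariantsRep_eq_coindOpenHRep_zero_of_finite`, the exponent
  `nrComplexPlaces_baseField_eq_index_galoisGroupAbove_mul`, finiteness of `𝓗¹(μ)`, `𝓗²(μ)` from the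
  Kummer pieces (`CoinducedKummerSequencePiecesPositiveDegree` fed by `SUnitsCoinducedKummerLayer`), and
  the model-free `ContinuousRep.euler_characteristic_of_psi_identity_of_zsmul` at `A := E_S[p]`
  (`#E_S[p] = p`, `natCard_torsionBy_resRep`; `W ∩ U` fixes `E_S[p]` and `M`,
  `resRep_torsionBy_apply_eq_self_of_mem`, `inflate_restrict_apply_eq_self_of_mem`);
* **`baseK_of_layerIdentity`**: the `hbase` instance `U = π⁻¹(C)` (`natCard_quotient_subgroupOf_comap`,
  `le_comap_mk'`, `compactSpace_subgroup_of_isOpen`).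

The remaining input `hId` is discharged by the Kummer file once its Brauer-class hypothesis `hH2` is
supplied by the invariant-vector file (FILE D); that composition is the lane closer's
`baseK_of_isTotallyComplex`.

Lane «TATE-EPC-TC» (cell `bsd-eis`, crux `GoodLatticeBDPValue`, stmt-BirchSwinnertonDyer-19032), brick
B8-alg (ADAPTER; recipe of width seat w7 gen 9, bus 2026-08-29T03:01:21Z).  HONEST FRAMING: conditional
on `hId`; no case of BSD and no case of Tate's theorem is proved in this file alone.

## References
* J. S. Milne, *Arithmetic Duality Theorems*, 2nd ed. (2006), I Thm. 5.1 (proof, pp. 69–70). [MilneADT2006]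
* J. Neukirch, A. Schmidt, K. Wingberg, *Cohomology of Number Fields*, 2nd ed. (2008), (8.7.4), VIII §3
  (8.3.18)–(8.3.20), (1.3.2). [NeukirchSchmidtWingberg2008]
-/

noncomputable section

open CategoryTheory Function
open scoped Topology

namespace Literature.NumberTheory.GaloisCohomology

open Literature.NumberTheory.GaloisRepresentations
open Literature.NumberTheory.GaloisRepresentations.DiscreteGaloisModule (mu MuCarrier)
open Literature.NumberTheory.GaloisRepresentations.OpenSubgroupLayer
open Literature.NumberTheory.GaloisRepresentations.IdeleClassBar (GalLayer)
open Literature.NumberTheory.GaloisRepresentations.LocalWeilDatum (galFixing)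
open Literature.NumberTheory.GaloisRepresentations.SUnits
open Literature.NumberTheory.GaloisRepresentations.SUnits.Layers
open Literature.NumberTheory.IwasawaTheory.Greenberg2006 (galoisGroupAbove)
open Literature.RepresentationTheory.FiniteGroups
open Literature.RepresentationTheory.FiniteGroups.StableLatticeReduction (torsionBy_le_comap smul_top_le_comap
  Int.finite_quotient_smul_top)
open _root_.TopRep _root_.ContRepresentation _root_.ContinuousCohomology
open NumberField Field IsDedekindDomain Submodule
open scoped NumberField Pointwise

variable {K : Type} [Field K] [NumberField K]

/-! ## §0 Finiteness of `𝓗¹(B[p])`, `𝓗²(B[p])` from the Kummer pieces (generic) -/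

section Generic

universe u

variable {G : Type u} [Group G] [TopologicalSpace G] [IsTopologicalGroup G] [CompactSpace G]
  [LocallyCompactSpace G]
variable {B : Type u} [AddCommGroup B] [TopologicalSpace B] [DiscreteTopology B]

/-- **`𝓗¹(B[p])` and `𝓗²(B[p])` are finite** (`𝓗ⁿ(A) = Hⁿ(G, Maps(G ⧸ W, A))`) when `B` is `p`-divisible,
`B^W` is finitely generated, `𝓗¹(B)` is finite and the `p`-torsion of `𝓗²(B)` is finite — the two Kummer
pieces `0 → 𝓗ⁿ⁻¹(B)/p → 𝓗ⁿ(B[p]) → 𝓗ⁿ(B)[p] → 0` (`CoinducedKummerSequencePiecesPositiveDegree`).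
[cite: NeukirchSchmidtWingberg2008, (1.3.2), VIII §3 (8.3.11)] -/
theorem finite_continuousCohomology_coindOpen_torsionBy_one_two (ρ : ContinuousRep G ℤ B)
    (W : Subgroup G) [W.Normal] (hW : IsOpen (W : Set G)) (p : ℕ) [hp : Fact p.Prime]
    (hdiv : Surjective fun b : B => (p : ℤ) • b) [Module.Finite ℤ (ρ.invariantsOf W)]
    [Finite (continuousCohomology 1 (ρ.coindOpen W hW).toTopRep)]
    (hTor2 : {y : continuousCohomology 2 (ρ.coindOpen W hW).toTopRep | p • y = 0}.Finite) :
    Finite (continuousCohomology 1 (((ρ.subrepresentation (torsionBy ℤ B (p : ℤ))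
        (torsionBy_le_comap ρ.toRepresentation (p : ℤ))).coindOpen W hW).toTopRep)) ∧
      Finite (continuousCohomology 2 (((ρ.subrepresentation (torsionBy ℤ B (p : ℤ))
        (torsionBy_le_comap ρ.toRepresentation (p : ℤ))).coindOpen W hW).toTopRep)) := by
  haveI : DiscreteTopology (G ⧸ W → B) := ContinuousRep.discreteTopology_coindOpen W hW
  haveI : DiscreteTopology (G ⧸ W → torsionBy ℤ B (p : ℤ)) := ContinuousRep.discreteTopology_coindOpen W hW
  -- `𝓗⁰(B) ≅ B^W` is finitely generated, so `𝓗⁰(B)/p` is finite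
  haveI : Module.Finite ℤ (ρ.coindOpen W hW).toTopRep.ρ.invariants :=
    Module.Finite.equiv (ρ.coindOpenInvariantsEquiv W hW).symm
  haveI : Finite ((ρ.coindOpen W hW).toTopRep.ρ.invariants ⧸
      ((p : ℤ) • ⊤ : Submodule ℤ (ρ.coindOpen W hW).toTopRep.ρ.invariants)) :=
    Int.finite_quotient_smul_top (by exact_mod_cast hp.out.ne_zero)
  have hN₀ : ∀ v : (ρ.coindOpen W hW).toTopRep.ρ.invariants,
      v ∈ ((p : ℤ) • ⊤ : Submodule ℤ (ρ.coindOpen W hW).toTopRep.ρ.invariants) ↔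
        ∃ w : (ρ.coindOpen W hW).toTopRep.ρ.invariants, (p : ℤ) • w = v := fun v => by
    rw [mem_smul_pointwise_iff_exists]
    exact ⟨fun ⟨w, _, h⟩ => ⟨w, h⟩, fun ⟨w, h⟩ => ⟨w, mem_top, h⟩⟩
  -- the `p`-torsion and the `p`-multiples of `𝓗¹(B)`, the `p`-torsion of `𝓗²(B)`
  -- the `p`-torsion / `p`-multiples of `𝓗¹(B)` as kernel / image of `𝓗¹(p•)` (the Kummer morphism `μ`;
  -- this spelling keeps the `Module ℤ` structure of the `ModuleCat` carriers out of the statements)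
  obtain ⟨ι, μ, -, hμ, -⟩ := ρ.exists_kummer_isSES p hdiv
  have hπ : ∀ x, (cohomologyMap (ρ.coindOpenMap ρ W hW μ) 1).hom.toLinearMap x = (p : ℤ) • x := fun x =>
    ρ.cohomologyMap_coindOpenMap_smul_apply W hW p μ hμ 1 x
  have hN₁ : ∀ t, t ∈ LinearMap.ker (cohomologyMap (ρ.coindOpenMap ρ W hW μ) 1).hom.toLinearMap ↔
      (p : ℤ) • t = 0 := fun t => by rw [LinearMap.mem_ker, hπ]
  have hN₁' : ∀ x, x ∈ LinearMap.range (cohomologyMap (ρ.coindOpenMap ρ W hW μ) 1).hom.toLinearMap ↔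
      ∃ y : continuousCohomology 1 (ρ.coindOpen W hW).toTopRep, (p : ℤ) • y = x := fun x => by
    simp only [LinearMap.mem_range, hπ]
  haveI : Finite (LinearMap.ker (cohomologyMap (ρ.coindOpenMap ρ W hW μ) 1).hom.toLinearMap) :=
    Finite.of_injective _ Subtype.val_injective
  haveI : Finite (continuousCohomology 1 (ρ.coindOpen W hW).toTopRep ⧸
      LinearMap.range (cohomologyMap (ρ.coindOpenMap ρ W hW μ) 1).hom.toLinearMap) :=
    Finite.of_surjective _ (Submodule.mkQ_surjective _)
  -- the `p`-torsion of `𝓗²(B)` (membership in `torsionBy` is stated with the `Module ℤ` structure of the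
  -- `ModuleCat` carrier, `hTor2` with the canonical `nsmul`: bridge `int_smul_eq_zsmul`)
  have hN₂ : ∀ t : continuousCohomology 2 (ρ.coindOpen W hW).toTopRep,
      t ∈ torsionBy ℤ (continuousCohomology 2 (ρ.coindOpen W hW).toTopRep) (p : ℤ) ↔ (p : ℤ) • t = 0 :=
    fun t => (mem_torsionBy_iff _ _).trans (Eq.congr_left
      (int_smul_eq_zsmul (continuousCohomology 2 (ρ.coindOpen W hW).toTopRep).isModule (p : ℤ) t))
  haveI : Finite (torsionBy ℤ (continuousCohomology 2 (ρ.coindOpen W hW).toTopRep) (p : ℤ)) := by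
    have hset : (SetLike.coe (torsionBy ℤ (continuousCohomology 2 (ρ.coindOpen W hW).toTopRep) (p : ℤ))) =
        {y : continuousCohomology 2 (ρ.coindOpen W hW).toTopRep | p • y = 0} := by
      ext t
      rw [SetLike.mem_coe, hN₂, Set.mem_setOf_eq, natCast_zsmul]
    exact (Set.finite_coe_iff.2 (hset ▸ hTor2) :)
  exact ⟨ρ.finite_continuousCohomology_one_coindOpen_torsionBy W hW p hdiv _ hN₀ _ hN₁,
    ρ.finite_continuousCohomology_two_coindOpen_torsionBy W hW p hdiv _ hN₁' _ hN₂⟩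

end Generic

/-! ## §1 `hbase` for a variable `U ⊇ W` from the layer identity -/

/-- **The prime-to-`p` base case of Tate's formula for one pair `W ≤ U ≤ G_{K,S}`, from the Kummer
identity at a layer.**  `K` totally complex, `S ⊇ S_p` finite, `ρ₀ ≅ μ_p`, `W` open normal in `G_S` fixing
`μ_p`, `U ⊇ W` compact with `p ∤ [U : W]`, `σ` a representation of `G_S ⧸ W` on a finite `M` with `pM = 0`.
HYPOTHESIS `hId` (the conclusion of `TateEulerCharacteristicKummerClasses.additive_coindOpen_mu_euler_of_brauerClass`,
token for token): for every open `H ≤ Γ_K` containing `N_S` with `galoisGroupAbove S H = U`, every finite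
Galois layer `E` of `K_S` above `K̄^H` whose layer subgroup is `W ∩ U`, and every `ℤ`-valued invariant
`ψ` of `ℤ[Δ]`-modules additive on short exact sequences of finite `p`-torsion modules,
`ψ((Maps(Δ, E_S[p]))^U) + ψ(𝓗²(E_S[p])) + r₂(K̄^H) • ψ(𝔽_p[Δ]) = ψ(𝓗¹(E_S[p]))`.  CONCLUSION: the `hbase`
line of `TateGlobalEulerCharacteristicTCOfBase.tateGlobalEulerPoincareCharacteristic_of_isTotallyComplex_of_base`
for `U`: `v_p #H⁰(U, M) − v_p #H¹(U, M) + v_p #H²(U, M) + [G_S : U] · r₂(K) · v_p #M = 0`.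
[cite: MilneADT2006, I Thm. 5.1 (proof)] [cite: NeukirchSchmidtWingberg2008, (8.7.4), (8.3.18)] -/
theorem euler_restrict_of_layerIdentity [IsTotallyComplex K]
    (S : Set (HeightOneSpectrum (𝓞 K))) (hS : S.Finite) (p : ℕ) [hp : Fact p.Prime]
    (hSp : ∀ v : HeightOneSpectrum (𝓞 K), ((p : ℕ) : 𝓞 K) ∈ v.asIdeal → v ∈ S)
    (ρ₀ : ContinuousRep (GaloisGroupUnramifiedOutside K S) ℤ (MuCarrier K p))
    (hρ₀ : ∀ (τ : absoluteGaloisGroup K) (v : MuCarrier K p), ρ₀ (toUnramifiedQuot K S τ) v = mu K p τ v)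
    (W U : Subgroup (GaloisGroupUnramifiedOutside K S)) [W.Normal]
    [DiscreteTopology (GaloisGroupUnramifiedOutside K S ⧸ W)]
    (hWU : W ≤ U) (hWo : IsOpen (W : Set (GaloisGroupUnramifiedOutside K S)))
    (hWfix : ∀ g ∈ W, ∀ v : MuCarrier K p, ρ₀ g v = v) [CompactSpace ↥U]
    (hcop : ¬ p ∣ Nat.card (↥U ⧸ W.subgroupOf U))
    (M : Type) [AddCommGroup M] [TopologicalSpace M] [DiscreteTopology M] [Finite M]
    (σ : Representation ℤ (GaloisGroupUnramifiedOutside K S ⧸ W) M) (hM : ∀ m : M, (p : ℤ) • m = 0)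
    (hId : ∀ (H : Subgroup (absoluteGaloisGroup K)) (hHo : IsOpen (H : Set (absoluteGaloisGroup K)))
      (hNH : ramificationSubgroup K S ≤ H), galoisGroupAbove S H = U →
      ∀ (E : GalLayer K) (hF : baseField H ≤ E.1) (hS' : ramificationSubgroup K S ≤ galFixing K E.1),
      ((layerSubgroup S hHo E hF hS' : OpenNormalSubgroup ↥(galoisGroupAbove S H)) :
          Subgroup ↥(galoisGroupAbove S H)) = W.subgroupOf (galoisGroupAbove S H) →
      ∀ [NumberField ↥(baseField H)] [CompactSpace ↥(galoisGroupAbove S H)]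
        [LocallyCompactSpace ↥(galoisGroupAbove S H)]
        (ψ : ∀ ⦃X : Type⦄ ⦃_ : AddCommGroup X⦄ ⦃_ : Module ℤ X⦄,
          Representation ℤ (↥(galoisGroupAbove S H) ⧸
            ((layerSubgroup S hHo E hF hS' : OpenNormalSubgroup ↥(galoisGroupAbove S H)) :
              Subgroup ↥(galoisGroupAbove S H))) X → ℤ),
        (∀ ⦃X Y Z : Type⦄ [AddCommGroup X] [Module ℤ X] [AddCommGroup Y] [Module ℤ Y]
          [AddCommGroup Z] [Module ℤ Z]
          (ρX : Representation ℤ (↥(galoisGroupAbove S H) ⧸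
            ((layerSubgroup S hHo E hF hS' : OpenNormalSubgroup ↥(galoisGroupAbove S H)) :
              Subgroup ↥(galoisGroupAbove S H))) X)
          (ρY : Representation ℤ (↥(galoisGroupAbove S H) ⧸
            ((layerSubgroup S hHo E hF hS' : OpenNormalSubgroup ↥(galoisGroupAbove S H)) :
              Subgroup ↥(galoisGroupAbove S H))) Y)
          (ρZ : Representation ℤ (↥(galoisGroupAbove S H) ⧸
            ((layerSubgroup S hHo E hF hS' : OpenNormalSubgroup ↥(galoisGroupAbove S H)) :
              Subgroup ↥(galoisGroupAbove S H))) Z)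
          (f : X →ₗ[ℤ] Y) (g : Y →ₗ[ℤ] Z),
          (∀ s x, f (ρX s x) = ρY s (f x)) → (∀ s y, g (ρY s y) = ρZ s (g y)) →
          Injective f → Surjective g → LinearMap.range f = LinearMap.ker g → Finite Y →
          (∀ y : Y, (p : ℤ) • y = 0) → ψ ρY = ψ ρX + ψ ρZ) →
        ψ (((resRep K S H).subrepresentation (torsionBy ℤ _ (p : ℤ))
              (torsionBy_le_comap (resRep K S H).toRepresentation (p : ℤ))).coindOpenInvariantsRep
            ((layerSubgroup S hHo E hF hS' : OpenNormalSubgroup ↥(galoisGroupAbove S H)) :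
              Subgroup ↥(galoisGroupAbove S H)) (layerSubgroup S hHo E hF hS').isOpen') +
          ψ (((resRep K S H).subrepresentation (torsionBy ℤ _ (p : ℤ))
              (torsionBy_le_comap (resRep K S H).toRepresentation (p : ℤ))).coindOpenHRep
            ((layerSubgroup S hHo E hF hS' : OpenNormalSubgroup ↥(galoisGroupAbove S H)) :
              Subgroup ↥(galoisGroupAbove S H)) (layerSubgroup S hHo E hF hS').isOpen' 2) +
          InfinitePlace.nrComplexPlaces ↥(baseField H) •
            ψ ((Representation.ofMulAction ℤ (↥(galoisGroupAbove S H) ⧸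
              ((layerSubgroup S hHo E hF hS' : OpenNormalSubgroup ↥(galoisGroupAbove S H)) :
                Subgroup ↥(galoisGroupAbove S H))) (↥(galoisGroupAbove S H) ⧸
              ((layerSubgroup S hHo E hF hS' : OpenNormalSubgroup ↥(galoisGroupAbove S H)) :
                Subgroup ↥(galoisGroupAbove S H)))).quotient ((p : ℤ) • ⊤) (smul_top_le_comap _ (p : ℤ))) =
        ψ (((resRep K S H).subrepresentation (torsionBy ℤ _ (p : ℤ))
              (torsionBy_le_comap (resRep K S H).toRepresentation (p : ℤ))).coindOpenHRep
            ((layerSubgroup S hHo E hF hS' : OpenNormalSubgroup ↥(galoisGroupAbove S H)) :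
              Subgroup ↥(galoisGroupAbove S H)) (layerSubgroup S hHo E hF hS').isOpen' 1)) :
    ((padicValNat p (Nat.card (continuousCohomology 0
        (((ContinuousRep.ofDiscrete σ).restrict (ContinuousMonoidHom.quotientMk W)).restrict
          (subgroupIncl U)).toTopRep)) : ℤ) -
        padicValNat p (Nat.card (continuousCohomology 1
          (((ContinuousRep.ofDiscrete σ).restrict (ContinuousMonoidHom.quotientMk W)).restrict
            (subgroupIncl U)).toTopRep)) +
        padicValNat p (Nat.card (continuousCohomology 2
          (((ContinuousRep.ofDiscrete σ).restrict (ContinuousMonoidHom.quotientMk W)).restrict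
            (subgroupIncl U)).toTopRep)) +
      ((U.index * InfinitePlace.nrComplexPlaces K : ℕ) : ℕ) * padicValNat p (Nat.card M)) = 0 := by
  classical
  -- (1) `U = galoisGroupAbove S H` for the open subgroup `H := π⁻¹ U` of `Γ_K`
  have hUo : IsOpen (U : Set (GaloisGroupUnramifiedOutside K S)) := Subgroup.isOpen_mono hWU hWo
  obtain ⟨H, hHo, hNH, hHU⟩ : ∃ H : Subgroup (absoluteGaloisGroup K),
      IsOpen (H : Set (absoluteGaloisGroup K)) ∧ ramificationSubgroup K S ≤ H ∧
        galoisGroupAbove S H = U :=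
    ⟨U.comap (toUnramifiedQuot K S), hUo.preimage (continuous_toUnramifiedQuot K S),
      ramificationSubgroup_le_comap_toUnramifiedQuot U, galoisGroupAbove_comap_toUnramifiedQuot U⟩
  subst hHU
  haveI : NumberField ↥(baseField H) := numberField_baseField S hHo hNH
  haveI : LocallyCompactSpace ↥(galoisGroupAbove S H) := inferInstance
  -- (2) `W ∩ U` is the layer subgroup of a finite Galois layer `E` of `K_S`
  obtain ⟨E, hF, hS', hEW⟩ := exists_galLayer_layerSubgroup_eq S hHo hNH W hWo hWU
  have hψId := hId H hHo hNH rfl E hF hS' hEW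
  -- abbreviations are avoided on purpose (instance paths); the layer subgroup and its openness:
  have hW : IsOpen (((layerSubgroup S hHo E hF hS' : OpenNormalSubgroup ↥(galoisGroupAbove S H)) :
      Subgroup ↥(galoisGroupAbove S H)) : Set ↥(galoisGroupAbove S H)) := (layerSubgroup S hHo E hF hS').isOpen'
  -- (3) the coefficient module `A := E_S[p]`: order `p`, discrete, fixed by `W ∩ U`
  have hcard : Nat.card (torsionBy ℤ (Representation.invariants
      ((sUnitsModule K S).toRepresentation.comp (ramificationSubgroup K S).subtype)) (p : ℤ)) = p :=
    natCard_torsionBy_resRep S hSp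
  haveI : Finite (torsionBy ℤ (Representation.invariants
      ((sUnitsModule K S).toRepresentation.comp (ramificationSubgroup K S).subtype)) (p : ℤ)) :=
    Nat.finite_of_card_ne_zero (by rw [hcard]; exact hp.out.ne_zero)
  let e : ZMod p ≃+ torsionBy ℤ (Representation.invariants
      ((sUnitsModule K S).toRepresentation.comp (ramificationSubgroup K S).subtype)) (p : ℤ) :=
    (ZMod.ringEquivCongr hcard.symm).toAddEquiv.trans
      (zmodAddCyclicAddEquiv (isAddCyclic_of_prime_card hcard))
  have hA : ∀ a : torsionBy ℤ (Representation.invariants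
      ((sUnitsModule K S).toRepresentation.comp (ramificationSubgroup K S).subtype)) (p : ℤ), (p : ℤ) • a = 0 :=
    fun a => Subtype.ext ((mem_torsionBy_iff _ _).1 a.2)
  have hWA : ∀ w ∈ ((layerSubgroup S hHo E hF hS' : OpenNormalSubgroup ↥(galoisGroupAbove S H)) :
        Subgroup ↥(galoisGroupAbove S H)), ∀ v,
      ((resRep K S H).subrepresentation (torsionBy ℤ _ (p : ℤ))
        (torsionBy_le_comap (resRep K S H).toRepresentation (p : ℤ))) w v = v := by
    rw [hEW]
    exact resRep_torsionBy_apply_eq_self_of_mem S ρ₀ hρ₀ W hWfix _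
  have hWM : ∀ w ∈ ((layerSubgroup S hHo E hF hS' : OpenNormalSubgroup ↥(galoisGroupAbove S H)) :
        Subgroup ↥(galoisGroupAbove S H)), ∀ m : M,
      (((ContinuousRep.ofDiscrete σ).restrict (ContinuousMonoidHom.quotientMk W)).restrict
        (subgroupIncl (galoisGroupAbove S H))) w m = m := by
    rw [hEW]
    exact inflate_restrict_apply_eq_self_of_mem W (galoisGroupAbove S H) σ
  have hcop' : ¬ p ∣ Nat.card (↥(galoisGroupAbove S H) ⧸
      ((layerSubgroup S hHo E hF hS' : OpenNormalSubgroup ↥(galoisGroupAbove S H)) :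
        Subgroup ↥(galoisGroupAbove S H))) := by
    rw [hEW]
    exact hcop
  -- (4) FINITENESS of `𝓗¹(E_S[p])`, `𝓗²(E_S[p])` (§0 with the FILE B inputs)
  haveI := totallyDisconnectedSpace_above (S := S) (H := H)
  haveI := finite_continuousCohomology_one_coindOpen_layer hHo hNH hS E hF hS'
  haveI := moduleFinite_invariantsOf_layerSubgroup hHo hS E hF hS'
  obtain ⟨hfin₁, hfin₂⟩ := finite_continuousCohomology_coindOpen_torsionBy_one_two (resRep K S H)
    ((layerSubgroup S hHo E hF hS' : OpenNormalSubgroup ↥(galoisGroupAbove S H)) :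
      Subgroup ↥(galoisGroupAbove S H)) hW p (zsmul_surjective_sUnitsRestricted K S hSp)
    (finite_torsion_continuousCohomology_two_coindOpen_layer hHo hNH hS E hF hS' hp.out.pos)
  -- (5) the exponent `r₂(K̄^H) = [G_S : U] · r₂(K)` and the degree-`0` rewrite, then the model-free
  --     Euler-characteristic computation at `A := E_S[p]`
  have hr : InfinitePlace.nrComplexPlaces ↥(baseField H) =
      (galoisGroupAbove S H).index * InfinitePlace.nrComplexPlaces K :=
    nrComplexPlaces_baseField_eq_index_galoisGroupAbove_mul H S (Subgroup.isClosed_of_isOpen H hHo) hNH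
  refine ((resRep K S H).subrepresentation (torsionBy ℤ _ (p : ℤ))
      (torsionBy_le_comap (resRep K S H).toRepresentation (p : ℤ))).euler_characteristic_of_psi_identity_of_zsmul
    (((ContinuousRep.ofDiscrete σ).restrict (ContinuousMonoidHom.quotientMk W)).restrict
      (subgroupIncl (galoisGroupAbove S H)))
    ((layerSubgroup S hHo E hF hS' : OpenNormalSubgroup ↥(galoisGroupAbove S H)) :
      Subgroup ↥(galoisGroupAbove S H))
    hW e hWA hWM hcop' _ hfin₁ hfin₂ (fun ψ hψ => ?_) hM
  have h0 := ((resRep K S H).subrepresentation (torsionBy ℤ _ (p : ℤ))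
      (torsionBy_le_comap (resRep K S H).toRepresentation (p : ℤ))).additive_coindOpenInvariantsRep_eq_coindOpenHRep_zero_of_finite
    ((layerSubgroup S hHo E hF hS' : OpenNormalSubgroup ↥(galoisGroupAbove S H)) :
      Subgroup ↥(galoisGroupAbove S H)) hW ψ hψ hA
  have hC := hψId ψ hψ
  -- first-order assembly (no rewriting under `ψ`)
  have key : ∀ (a b : ℕ) (X0 X0' X1 X2 R : ℤ), a = b → X0 = X0' →
      X0 + X2 + a • R = X1 → X0' + X2 + b • R = X1 := by
    intro a b X0 X0' X1 X2 R hab h0 h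
    subst hab h0
    exact h
  exact key _ _ _ _ _ _ _ hr h0 hC

/-! ## §2 `hbase` for `U = π⁻¹(C)` -/

/-- **`hbase` for `U = π⁻¹(C)`, `C ≤ G_S ⧸ W` of order prime to `p`** (the binders of
`tateGlobalEulerPoincareCharacteristic_of_isTotallyComplex_of_base`; cyclicity of `C` is not needed),
from the layer identity `hId` (the conclusion of
`TateEulerCharacteristicKummerClasses.additive_coindOpen_mu_euler_of_brauerClass` for every `(H, E)` with
`galoisGroupAbove S H = π⁻¹(C)` and layer subgroup `W ∩ π⁻¹(C)`); the instance `CompactSpace ↥(π⁻¹ C)` is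
`compactSpace_subgroup_of_isOpen`. [cite: MilneADT2006, I Thm. 5.1 (proof)] [cite: NeukirchSchmidtWingberg2008, (8.7.4)] -/
theorem baseK_of_layerIdentity [IsTotallyComplex K]
    (S : Set (HeightOneSpectrum (𝓞 K))) (hS : S.Finite) (p : ℕ) [Fact p.Prime]
    (hSp : ∀ v : HeightOneSpectrum (𝓞 K), ((p : ℕ) : 𝓞 K) ∈ v.asIdeal → v ∈ S)
    (ρ₀ : ContinuousRep (GaloisGroupUnramifiedOutside K S) ℤ (MuCarrier K p))
    (hρ₀ : ∀ (τ : absoluteGaloisGroup K) (v : MuCarrier K p), ρ₀ (toUnramifiedQuot K S τ) v = mu K p τ v)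
    (W : Subgroup (GaloisGroupUnramifiedOutside K S)) [W.Normal]
    [DiscreteTopology (GaloisGroupUnramifiedOutside K S ⧸ W)]
    (hWo : IsOpen (W : Set (GaloisGroupUnramifiedOutside K S)))
    (hWfix : ∀ g ∈ W, ∀ v : MuCarrier K p, ρ₀ g v = v)
    (C : Subgroup (GaloisGroupUnramifiedOutside K S ⧸ W)) (hC : (Nat.card C).Coprime p)
    (M : Type) [AddCommGroup M] [TopologicalSpace M] [DiscreteTopology M] [Finite M]
    (σ : Representation ℤ (GaloisGroupUnramifiedOutside K S ⧸ W) M) (hM : ∀ m : M, (p : ℤ) • m = 0)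
    (hId : ∀ (H : Subgroup (absoluteGaloisGroup K)) (hHo : IsOpen (H : Set (absoluteGaloisGroup K)))
      (hNH : ramificationSubgroup K S ≤ H), galoisGroupAbove S H = C.comap (QuotientGroup.mk' W) →
      ∀ (E : GalLayer K) (hF : baseField H ≤ E.1) (hS' : ramificationSubgroup K S ≤ galFixing K E.1),
      ((layerSubgroup S hHo E hF hS' : OpenNormalSubgroup ↥(galoisGroupAbove S H)) :
          Subgroup ↥(galoisGroupAbove S H)) = W.subgroupOf (galoisGroupAbove S H) →
      ∀ [NumberField ↥(baseField H)] [CompactSpace ↥(galoisGroupAbove S H)]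
        [LocallyCompactSpace ↥(galoisGroupAbove S H)]
        (ψ : ∀ ⦃X : Type⦄ ⦃_ : AddCommGroup X⦄ ⦃_ : Module ℤ X⦄,
          Representation ℤ (↥(galoisGroupAbove S H) ⧸
            ((layerSubgroup S hHo E hF hS' : OpenNormalSubgroup ↥(galoisGroupAbove S H)) :
              Subgroup ↥(galoisGroupAbove S H))) X → ℤ),
        (∀ ⦃X Y Z : Type⦄ [AddCommGroup X] [Module ℤ X] [AddCommGroup Y] [Module ℤ Y]
          [AddCommGroup Z] [Module ℤ Z]
          (ρX : Representation ℤ (↥(galoisGroupAbove S H) ⧸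
            ((layerSubgroup S hHo E hF hS' : OpenNormalSubgroup ↥(galoisGroupAbove S H)) :
              Subgroup ↥(galoisGroupAbove S H))) X)
          (ρY : Representation ℤ (↥(galoisGroupAbove S H) ⧸
            ((layerSubgroup S hHo E hF hS' : OpenNormalSubgroup ↥(galoisGroupAbove S H)) :
              Subgroup ↥(galoisGroupAbove S H))) Y)
          (ρZ : Representation ℤ (↥(galoisGroupAbove S H) ⧸
            ((layerSubgroup S hHo E hF hS' : OpenNormalSubgroup ↥(galoisGroupAbove S H)) :
              Subgroup ↥(galoisGroupAbove S H))) Z)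
          (f : X →ₗ[ℤ] Y) (g : Y →ₗ[ℤ] Z),
          (∀ s x, f (ρX s x) = ρY s (f x)) → (∀ s y, g (ρY s y) = ρZ s (g y)) →
          Injective f → Surjective g → LinearMap.range f = LinearMap.ker g → Finite Y →
          (∀ y : Y, (p : ℤ) • y = 0) → ψ ρY = ψ ρX + ψ ρZ) →
        ψ (((resRep K S H).subrepresentation (torsionBy ℤ _ (p : ℤ))
              (torsionBy_le_comap (resRep K S H).toRepresentation (p : ℤ))).coindOpenInvariantsRep
            ((layerSubgroup S hHo E hF hS' : OpenNormalSubgroup ↥(galoisGroupAbove S H)) :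
              Subgroup ↥(galoisGroupAbove S H)) (layerSubgroup S hHo E hF hS').isOpen') +
          ψ (((resRep K S H).subrepresentation (torsionBy ℤ _ (p : ℤ))
              (torsionBy_le_comap (resRep K S H).toRepresentation (p : ℤ))).coindOpenHRep
            ((layerSubgroup S hHo E hF hS' : OpenNormalSubgroup ↥(galoisGroupAbove S H)) :
              Subgroup ↥(galoisGroupAbove S H)) (layerSubgroup S hHo E hF hS').isOpen' 2) +
          InfinitePlace.nrComplexPlaces ↥(baseField H) •
            ψ ((Representation.ofMulAction ℤ (↥(galoisGroupAbove S H) ⧸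
              ((layerSubgroup S hHo E hF hS' : OpenNormalSubgroup ↥(galoisGroupAbove S H)) :
                Subgroup ↥(galoisGroupAbove S H))) (↥(galoisGroupAbove S H) ⧸
              ((layerSubgroup S hHo E hF hS' : OpenNormalSubgroup ↥(galoisGroupAbove S H)) :
                Subgroup ↥(galoisGroupAbove S H)))).quotient ((p : ℤ) • ⊤) (smul_top_le_comap _ (p : ℤ))) =
        ψ (((resRep K S H).subrepresentation (torsionBy ℤ _ (p : ℤ))
              (torsionBy_le_comap (resRep K S H).toRepresentation (p : ℤ))).coindOpenHRep
            ((layerSubgroup S hHo E hF hS' : OpenNormalSubgroup ↥(galoisGroupAbove S H)) :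
              Subgroup ↥(galoisGroupAbove S H)) (layerSubgroup S hHo E hF hS').isOpen' 1)) :
    ((padicValNat p (Nat.card (continuousCohomology 0
        (((ContinuousRep.ofDiscrete σ).restrict (ContinuousMonoidHom.quotientMk W)).restrict
          (subgroupIncl (C.comap (QuotientGroup.mk' W)))).toTopRep)) : ℤ) -
        padicValNat p (Nat.card (continuousCohomology 1
          (((ContinuousRep.ofDiscrete σ).restrict (ContinuousMonoidHom.quotientMk W)).restrict
            (subgroupIncl (C.comap (QuotientGroup.mk' W)))).toTopRep)) +
        padicValNat p (Nat.card (continuousCohomology 2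
          (((ContinuousRep.ofDiscrete σ).restrict (ContinuousMonoidHom.quotientMk W)).restrict
            (subgroupIncl (C.comap (QuotientGroup.mk' W)))).toTopRep)) +
      ((C.comap (QuotientGroup.mk' W)).index * InfinitePlace.nrComplexPlaces K : ℕ) *
        padicValNat p (Nat.card M)) = 0 := by
  haveI : CompactSpace ↥(C.comap (QuotientGroup.mk' W)) :=
    compactSpace_subgroup_of_isOpen (C.comap (QuotientGroup.mk' W))
      (Subgroup.isOpen_mono (le_comap_mk' W C) hWo)
  exact euler_restrict_of_layerIdentity S hS p hSp ρ₀ hρ₀ W (C.comap (QuotientGroup.mk' W)) (le_comap_mk' W C)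
    hWo hWfix (by
      rw [natCard_quotient_subgroupOf_comap W C]
      exact fun h => (Fact.out : p.Prime).ne_one (Nat.eq_one_of_dvd_coprimes hC h dvd_rfl))
    M σ hM hId

end Literature.NumberTheory.GaloisCohomology

end
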